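import Summits.QuantumFields.YangMills.Theorems.BalabanUVNodesN08HaarCompatibilityGuardIntrinsicJacobian
import Summits.QuantumFields.YangMills.Theorems.BalabanUVNodesN08HaarCompatibilityGuardInjectivityWindows
import Summits.QuantumFields.YangMills.Theorems.BalabanUVNodesN08HaarCompatibilityGuardCoreKmatDictionary

/-!
# BalabanUVNodes ∕ N08 — THE PRINTED exp-mean-log CORE MAP ALONG A CHART WINDOW OF `SU(N)`, EVERY `N`: dictionary to lit-balaban's exponential chart,
# the determinant pinch `(1 − Σcᵢ)^{N²−1} ≤ |det T| ≤ 1` on the chart algebra, and the uniform Lipschitz modulus `‖Kmat(W₀e^X) − Kmat(W₀)‖ ≤ 2B‖X‖`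

WIDTH SEAT `pub-ymgap-dag-n08-w6` g5, item-3 lineage, 2026-08-28 (INTENT-2, part A of the 400-line split).  DAG node N08 = [Balaban1985UV3] Thm 1 p. 257 (compact) +
Thm 2 p. 272; the typed (0.4) averaging and its guard = [Balaban1987RG1] (0.4) p. 253; key item K1⁷ `StabilityBAtRecordR13SepCoPH` (stmt-QuantumFields-20542),
`--supports … --as helper`.  COUNT-NEUTRAL.

THE POINT.  `…GuardIntrinsicJacobian` (this seat, INTENT-1) reduces a density bound `μ∘Φ⁻¹ ≤ (m⁻¹·#K + 1)•μ` on every log-charted compact group to PER-WINDOW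
data in the exponential chart of lit-balaban's `IsChartRep`.  This file and its sequel `…GuardCoreChartConjugateSUN` supply that data for the PRINTED exp-mean-log
core map `w ↦ Kmat V c w` (pub-balaban's `T4EMLTangentInjective.Kmat`; = the core map of (H_K-core) by p624108 `core_eq_kmat`) on `SU(N)`, EVERY `N`.  Here:
 §1 dictionary (`coe_expChart`, `coe_mul_expChart`, `lieSU_eq_lie`, `coe_inv_eq_star`, `exp_neg_eq_star`) and ★ `abs_det_pinch_lie`: the two-sided pinch
    `(1 − Σcᵢ)^{N²−1} ≤ |det T| ≤ 1` of p621515 `abs_det_leftTangentSU_pinch` TRANSPORTED from pub-balaban's `lieSU` to the chart algebra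
    `(specialUnitaryLogChart (Fin N)).lie` (same carrier; `LinearMap.det_conj`), with existence `exists_leftTangent_lie` (A6);
 §2 `norm_adg_le`, `norm_jac_le_two` (`‖jac X‖ ≤ 2` on `‖X‖ ≤ 1∕2` from `‖g(T) − 1‖ ≤ (e^{‖T‖} − 1)∕2`), `guard_lt_half_of_exp`, and ★ `norm_kmat_expChart_sub_le` —
    THE LIPSCHITZ MODULUS OF THE CORE MAP ALONG A WINDOW: `‖Kmat V c (W₀·e^X) − Kmat V c W₀‖ ≤ 2B·‖X‖` for `X ∈ 𝔰𝔲(N)`, `‖X‖ < r` (`B` = p626433's uniform bound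
    `exists_bound_emlD` on the `1∕2`-guard, `r ≤ 1∕2` below the radius where `‖e^{Z} − 1‖ < 1∕6`; mean-value inequality on the convex ball of `𝔰𝔲(N)` with INTENT-1's
    `hasFDerivAt_coe_exp`), the radii depending on `N`, the weights and the index type only.

HONEST FRAMING.  [folklore] matrix calculus ∕ bookkeeping over pub-balaban's `Kmat`∕`emlD`, lit-balaban's exponential chart of `SU(N)` and this lineage's determinant pinch
BY IMPORT; nothing of Bałaban's asserted; (H_K) ∕ (H_K-core) NOT discharged in this file; E6′ NOT decided; `hmass` NOT supplied; count-neutral; N08 NOT discharged; counts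
unmoved (typed 28∕28 · discharged 5∕27); one finite 𝕋⁴ programme at fixed ε — R4 closes the CONDITIONAL rung `BalabanLadder.UV` only; the Yang–Mills mass gap (Clay) is
NOT proved; nothing continuum ∕ OS.  0 `sorry`, 0 `def`, 0 `instance`, 0 `notation` (the group is spelled `Matrix.specialUnitaryGroup (Fin N) ℂ`, the chart
`isChartRep_specialUnitaryGroup (n := Fin N)` throughout), standard axioms.
-/

noncomputable section

open NormedSpace Set Function Filter Topology MeasureTheory
open scoped ENNReal NNReal Matrix Matrix.Norms.L2Operator

namespace Summit.QuantumFields.YangMills.BalabanUVNodes.N08HaarCompatibilityGuardCoreWindowLipschitzSUN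

open Literature.MathematicalPhysics.QuantumFieldTheory.Balaban1983to89
open Literature.MathematicalPhysics.QuantumFieldTheory.Balaban1983to89.HaarExponentialChart
open Literature.MathematicalPhysics.QuantumFieldTheory.Balaban1983to89.HaarExponentialChart.IsChartRep (chartRadius innerRadius)
open Literature.MathematicalPhysics.QuantumFieldTheory.Balaban1983to89.B13HaarSigmaJacobian (jac adg adg_apply_coe)
open Literature.MathematicalPhysics.QuantumFieldTheory.Balaban1983to89.T4EMLTangentInjective (Kmat emlD hasStrictFDerivAt_Kmat)
open Literature.MathematicalPhysics.QuantumFieldTheory.Balaban1983to89.T4AdjointCovarianceUnitary (lieSU mem_lieSU_iff)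
open Literature.MathematicalPhysics.QuantumFieldTheory.Balaban1983to89.ExpMeanLog (deltaSU lt_third_of_lt_deltaSU)
open Literature.MathematicalPhysics.QuantumFieldTheory.Balaban1983to89.MatrixLog (mlog)
open Literature.Analysis.Calculus.ExpDifferential (gSer norm_gSer_sub_one_le exp_neg_mul_exp_eq_one)
open Literature.MathematicalPhysics.QuantumLattice (fundamentalRep fundamentalRep_apply)
open Summit.QuantumFields.YangMills.BalabanUVNodes.N08HaarCompatibilityGuardIntrinsicJacobian
open Summit.QuantumFields.YangMills.BalabanUVNodes.N08HaarCompatibilityGuardInjectivityWindows (uniform_injectivity_windows exists_bound_emlD exists_norm_exp_sub_one_lt)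
open Summit.QuantumFields.YangMills.BalabanUVNodes.N08HaarCompatibilityGuardJacobianDet (kmat_mem_unitaryGroup)
open Summit.QuantumFields.YangMills.BalabanUVNodes.N08HaarCompatibilityGuardJacobianDetSU (exists_leftTangent_lieSU guard_half_of_deltaSU)
open Summit.QuantumFields.YangMills.BalabanUVNodes.N08HaarCompatibilityGuardJacobianContractionDet (abs_det_leftTangentSU_pinch_specialUnitary)

variable {N : ℕ} [NeZero N] {ι : Type*} [Fintype ι]

/-! ## §1 Dictionary: the exponential chart of `SU(N)`, the chart algebra `𝔰𝔲(N)`, and the transported determinant pinch -/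

/-- `↑(Θ X) = e^{X}` for the exponential chart of `SU(N)`. [cite: Helgason2000, Ch. I §1 Thm. 1.14 (13) p. 96] -/
theorem coe_expChart (X : (specialUnitaryLogChart (Fin N)).lie) :
    (((isChartRep_specialUnitaryGroup (n := Fin N)).expChart X : Matrix.specialUnitaryGroup (Fin N) ℂ) : Matrix (Fin N) (Fin N) ℂ) =
      exp (X : Matrix (Fin N) (Fin N) ℂ) :=
  (isChartRep_specialUnitaryGroup (n := Fin N)).rho_expChart X

/-- `↑(W₀ · Θ X) = ↑W₀ · e^{X}`. [cite: Helgason2000, Ch. I §1 Thm. 1.14 (13) p. 96] -/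
theorem coe_mul_expChart (W₀ : Matrix.specialUnitaryGroup (Fin N) ℂ) (X : (specialUnitaryLogChart (Fin N)).lie) :
    ((W₀ * (isChartRep_specialUnitaryGroup (n := Fin N)).expChart X : Matrix.specialUnitaryGroup (Fin N) ℂ) : Matrix (Fin N) (Fin N) ℂ) =
      (W₀ : Matrix (Fin N) (Fin N) ℂ) * exp (X : Matrix (Fin N) (Fin N) ℂ) := by
  rw [Submonoid.coe_mul, coe_expChart]

/-- pub-balaban's `lieSU (Fin N)` IS the chart algebra `(specialUnitaryLogChart (Fin N)).lie` (same carrier `{X* = −X, tr X = 0}`). [folklore] -/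
theorem lieSU_eq_lie : lieSU (Fin N) = (specialUnitaryLogChart (Fin N)).lie := by
  ext X
  rw [mem_lieSU_iff, mem_specialUnitaryLogChart_lie]

omit [NeZero N] in
/-- The inverse in `SU(N)` is the adjoint: `↑(g⁻¹) = (↑g)*`. [folklore] -/
theorem coe_inv_eq_star (g : Matrix.specialUnitaryGroup (Fin N) ℂ) :
    ((g⁻¹ : Matrix.specialUnitaryGroup (Fin N) ℂ) : Matrix (Fin N) (Fin N) ℂ) = star (g : Matrix (Fin N) (Fin N) ℂ) := by
  rw [← Matrix.star_eq_inv]; rfl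

omit [NeZero N] in
/-- If `e^{A} = U` with `U` unitary then `e^{−A} = U*`. [folklore] -/
theorem exp_neg_eq_star {A U : Matrix (Fin N) (Fin N) ℂ} (hU : U ∈ Matrix.unitaryGroup (Fin N) ℂ) (hA : exp A = U) : exp (-A) = star U := by
  have h1 : exp (-A) * U = 1 := by rw [← hA]; exact exp_neg_mul_exp_eq_one (𝕂 := ℂ) A
  calc exp (-A) = exp (-A) * (U * star U) := by rw [Matrix.mem_unitaryGroup_iff.mp hU, mul_one]
    _ = star U := by rw [← mul_assoc, h1, one_mul]

/-- ★ **THE TWO-SIDED DETERMINANT PINCH ON THE CHART ALGEBRA.**  For `V : ι → SU(N)`, `W ∈ SU(N)` in the typed guard `‖VᵢW* − 1‖ < deltaSU`, weights `cᵢ ≥ 0`,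
`Σcᵢ ≤ 1`, and ANY `ℝ`-linear endomorphism `T` of `(specialUnitaryLogChart (Fin N)).lie` agreeing with the left-trivialised tangent map `(Kmat W)*·emlD W (W·)`:
`(1 − Σcᵢ)^{N²−1} ≤ |det T| ≤ 1` (p621515 `abs_det_leftTangentSU_pinch_specialUnitary` transported along `lieSU_eq_lie`; `LinearMap.det_conj`). [folklore] -/
theorem abs_det_pinch_lie (V : ι → Matrix.specialUnitaryGroup (Fin N) ℂ) (W : Matrix.specialUnitaryGroup (Fin N) ℂ)
    (hg : ∀ i, ‖(V i : Matrix (Fin N) (Fin N) ℂ) * star (W : Matrix (Fin N) (Fin N) ℂ) - 1‖ < deltaSU (Fin N))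
    {c : ι → ℝ} (hc0 : ∀ i, 0 ≤ c i) (hc1 : ∑ i, c i ≤ 1)
    (T : (specialUnitaryLogChart (Fin N)).lie →ₗ[ℝ] (specialUnitaryLogChart (Fin N)).lie)
    (hT : ∀ v : (specialUnitaryLogChart (Fin N)).lie, ((T v : (specialUnitaryLogChart (Fin N)).lie) : Matrix (Fin N) (Fin N) ℂ) =
      star (Kmat (fun i => (V i : Matrix (Fin N) (Fin N) ℂ)) c (W : Matrix (Fin N) (Fin N) ℂ)) *
        emlD (fun i => (V i : Matrix (Fin N) (Fin N) ℂ)) c (W : Matrix (Fin N) (Fin N) ℂ) ((W : Matrix (Fin N) (Fin N) ℂ) * (v : Matrix (Fin N) (Fin N) ℂ))) :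
    (1 - ∑ i, c i) ^ (N ^ 2 - 1) ≤ |LinearMap.det T| ∧ |LinearMap.det T| ≤ 1 := by
  let e : (specialUnitaryLogChart (Fin N)).lie ≃ₗ[ℝ] lieSU (Fin N) := LinearEquiv.ofEq _ _ lieSU_eq_lie.symm
  let T' : lieSU (Fin N) →ₗ[ℝ] lieSU (Fin N) := (e : _ →ₗ[ℝ] lieSU (Fin N)) ∘ₗ T ∘ₗ (e.symm : lieSU (Fin N) →ₗ[ℝ] _)
  have hdet : LinearMap.det T' = LinearMap.det T := LinearMap.det_conj T e
  have hT' : ∀ X : lieSU (Fin N), ((T' X : lieSU (Fin N)) : Matrix (Fin N) (Fin N) ℂ) =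
      star (Kmat (fun i => (V i : Matrix (Fin N) (Fin N) ℂ)) c (W : Matrix (Fin N) (Fin N) ℂ)) *
        emlD (fun i => (V i : Matrix (Fin N) (Fin N) ℂ)) c (W : Matrix (Fin N) (Fin N) ℂ) ((W : Matrix (Fin N) (Fin N) ℂ) * (X : Matrix (Fin N) (Fin N) ℂ)) :=
    fun X => hT (e.symm X)
  have h := abs_det_leftTangentSU_pinch_specialUnitary V W hg hc0 hc1 T' hT'
  rwa [hdet, Fintype.card_fin] at h

/-- **Existence** of such a `T` on the chart algebra (non-vacuity, A6; p617624 `exists_leftTangent_lieSU` transported). [folklore] -/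
theorem exists_leftTangent_lie (V : ι → Matrix.specialUnitaryGroup (Fin N) ℂ) (W : Matrix.specialUnitaryGroup (Fin N) ℂ)
    (hg : ∀ i, ‖(V i : Matrix (Fin N) (Fin N) ℂ) * star (W : Matrix (Fin N) (Fin N) ℂ) - 1‖ < deltaSU (Fin N)) (c : ι → ℝ) :
    ∃ T : (specialUnitaryLogChart (Fin N)).lie →ₗ[ℝ] (specialUnitaryLogChart (Fin N)).lie,
      ∀ v : (specialUnitaryLogChart (Fin N)).lie, ((T v : (specialUnitaryLogChart (Fin N)).lie) : Matrix (Fin N) (Fin N) ℂ) =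
        star (Kmat (fun i => (V i : Matrix (Fin N) (Fin N) ℂ)) c (W : Matrix (Fin N) (Fin N) ℂ)) *
          emlD (fun i => (V i : Matrix (Fin N) (Fin N) ℂ)) c (W : Matrix (Fin N) (Fin N) ℂ) ((W : Matrix (Fin N) (Fin N) ℂ) * (v : Matrix (Fin N) (Fin N) ℂ)) := by
  obtain ⟨T, hT⟩ := exists_leftTangent_lieSU (fun i => (V i).2) W.2 hg c
  let e : (specialUnitaryLogChart (Fin N)).lie ≃ₗ[ℝ] lieSU (Fin N) := LinearEquiv.ofEq _ _ lieSU_eq_lie.symm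
  exact ⟨(e.symm : lieSU (Fin N) →ₗ[ℝ] _) ∘ₗ T ∘ₗ (e : _ →ₗ[ℝ] lieSU (Fin N)), fun v => hT (e v)⟩

/-! ## §2 The Lipschitz modulus of the core map along a window -/

/-- `‖ad_𝔤 X‖ ≤ 2‖X‖` on the chart algebra. [folklore] -/
theorem norm_adg_le (X : (specialUnitaryLogChart (Fin N)).lie) :
    ‖adg (lie_adStable_specialUnitaryGroup (n := Fin N)) X‖ ≤ 2 * ‖X‖ := by
  refine ContinuousLinearMap.opNorm_le_bound _ (by positivity) fun Y => ?_
  rw [← Submodule.norm_coe, adg_apply_coe, ← Submodule.norm_coe, ← Submodule.norm_coe]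
  calc ‖(X : Matrix (Fin N) (Fin N) ℂ) * Y - Y * X‖ ≤ ‖(X : Matrix (Fin N) (Fin N) ℂ) * Y‖ + ‖(Y : Matrix (Fin N) (Fin N) ℂ) * X‖ := norm_sub_le _ _
    _ ≤ ‖(X : Matrix (Fin N) (Fin N) ℂ)‖ * ‖(Y : Matrix (Fin N) (Fin N) ℂ)‖ + ‖(Y : Matrix (Fin N) (Fin N) ℂ)‖ * ‖(X : Matrix (Fin N) (Fin N) ℂ)‖ :=
        add_le_add (norm_mul_le _ _) (norm_mul_le _ _)
    _ = 2 * ‖(X : Matrix (Fin N) (Fin N) ℂ)‖ * ‖(Y : Matrix (Fin N) (Fin N) ℂ)‖ := by ring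

/-- `‖jac X‖ ≤ 2` for `‖X‖ ≤ 1∕2` (`jac X = g(ad X)`, `‖g(T) − 1‖ ≤ (e^{‖T‖} − 1)∕2`, `‖ad X‖ ≤ 1`). [cite: Helgason2000, Ch. I §1 Thm. 1.14 (12) p. 96] -/
theorem norm_jac_le_two {X : (specialUnitaryLogChart (Fin N)).lie} (hX : ‖X‖ ≤ 1 / 2) :
    ‖jac (lie_adStable_specialUnitaryGroup (n := Fin N)) X‖ ≤ 2 := by
  have had : ‖adg (lie_adStable_specialUnitaryGroup (n := Fin N)) X‖ ≤ 1 := (norm_adg_le X).trans (by linarith)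
  have h1 := norm_gSer_sub_one_le (𝕂 := ℝ) (adg (lie_adStable_specialUnitaryGroup (n := Fin N)) X)
  have he : Real.exp ‖adg (lie_adStable_specialUnitaryGroup (n := Fin N)) X‖ ≤ Real.exp 1 := Real.exp_le_exp.2 had
  have he1 : Real.exp 1 < 3 := by have := Real.exp_one_lt_d9; linarith
  have htri : ‖jac (lie_adStable_specialUnitaryGroup (n := Fin N)) X‖
      ≤ ‖jac (lie_adStable_specialUnitaryGroup (n := Fin N)) X - 1‖ + ‖(1 : (specialUnitaryLogChart (Fin N)).lie →L[ℝ] (specialUnitaryLogChart (Fin N)).lie)‖ := by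
    have h := norm_add_le (jac (lie_adStable_specialUnitaryGroup (n := Fin N)) X - 1) (1 : (specialUnitaryLogChart (Fin N)).lie →L[ℝ] (specialUnitaryLogChart (Fin N)).lie)
    rwa [sub_add_cancel] at h
  have hid : ‖(1 : (specialUnitaryLogChart (Fin N)).lie →L[ℝ] (specialUnitaryLogChart (Fin N)).lie)‖ ≤ 1 := ContinuousLinearMap.norm_id_le
  have h2 : ‖jac (lie_adStable_specialUnitaryGroup (n := Fin N)) X - 1‖ ≤ (Real.exp 1 - 1) / 2 := h1.trans (by gcongr)
  linarith

omit [Fintype ι] in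
/-- **THE GUARD ALONG A WINDOW**: for `X ∈ 𝔰𝔲(N)` with `‖e^{−X} − 1‖ < 1∕6` and a centre in the typed guard (`‖VᵢW₀* − 1‖ < deltaSU ≤ 1∕3`), the point `W₀e^X` is in the
`1∕2`-guard: `‖Vᵢ(W₀e^X)* − 1‖ < 1∕2`. [folklore] -/
theorem guard_lt_half_of_exp {V : ι → Matrix (Fin N) (Fin N) ℂ} (hV : ∀ i, V i ∈ Matrix.unitaryGroup (Fin N) ℂ)
    {W₀ : Matrix (Fin N) (Fin N) ℂ} (hW₀ : W₀ ∈ Matrix.unitaryGroup (Fin N) ℂ)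
    (hg : ∀ i, ‖V i * star W₀ - 1‖ < deltaSU (Fin N)) {X : Matrix (Fin N) (Fin N) ℂ} (hXs : star X = -X)
    (hX : ‖exp (-X) - 1‖ < 1 / 6) (i : ι) :
    ‖V i * star (W₀ * exp X) - 1‖ < 1 / 2 := by
  have h3 : ‖V i * star W₀ - 1‖ < 1 / 3 := lt_third_of_lt_deltaSU (hg i)
  have hstar : star (exp X) = exp (-X) := by
    rw [star_exp, hXs]
  have e : V i * star (W₀ * exp X) - 1 = V i * (exp (-X) - 1) * star W₀ + (V i * star W₀ - 1) := by
    rw [star_mul, hstar]; noncomm_ring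
  have hnV : ‖V i‖ = 1 := CStarRing.norm_of_mem_unitary (hV i)
  have hnW : ‖star W₀‖ = 1 := CStarRing.norm_of_mem_unitary (Unitary.star_mem hW₀)
  rw [e]
  calc ‖V i * (exp (-X) - 1) * star W₀ + (V i * star W₀ - 1)‖
      ≤ ‖V i * (exp (-X) - 1) * star W₀‖ + ‖V i * star W₀ - 1‖ := norm_add_le _ _
    _ ≤ ‖V i‖ * ‖exp (-X) - 1‖ * ‖star W₀‖ + ‖V i * star W₀ - 1‖ :=
        add_le_add ((norm_mul_le _ _).trans (mul_le_mul_of_nonneg_right (norm_mul_le _ _) (norm_nonneg _))) le_rfl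
    _ < 1 * (1 / 6) * 1 + 1 / 3 := by rw [hnV, hnW]; gcongr
    _ = 1 / 2 := by norm_num

/-- ★ **THE LIPSCHITZ MODULUS OF THE CORE MAP ALONG A WINDOW.**  Let `B` bound `‖emlD V c W‖` on the closed `1∕2`-guard (p626433 `exists_bound_emlD`), let
`0 < r ≤ 1∕2` be such that `‖Z‖ < r ⇒ ‖e^{Z} − 1‖ < 1∕6` in `M_N(ℂ)`, and let the centre `W₀ ∈ SU(N)` be in the typed guard.  Then for `X ∈ 𝔰𝔲(N)`, `‖X‖ < r`:
**`‖Kmat V c (W₀e^X) − Kmat V c W₀‖ ≤ 2B·‖X‖`** (mean-value inequality on the convex ball of the chart algebra; derivative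
`emlD(W₀e^Y) ∘ (W₀·) ∘ (e^Y·jac Y ·)` of norm `≤ B·1·1·2`). [folklore] -/
theorem norm_kmat_expChart_sub_le (V : ι → Matrix.specialUnitaryGroup (Fin N) ℂ) (c : ι → ℝ) {B : ℝ} (hB0 : 0 < B)
    (hB : ∀ (h : ι → Matrix (Fin N) (Fin N) ℂ) (W : Matrix (Fin N) (Fin N) ℂ), (∀ i, h i ∈ Matrix.unitaryGroup (Fin N) ℂ) →
      W ∈ Matrix.unitaryGroup (Fin N) ℂ → (∀ i, ‖h i * star W - 1‖ ≤ 1 / 2) → ‖emlD h c W‖ ≤ B)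
    {r : ℝ} (hr2 : r ≤ 1 / 2) (hre : ∀ Z : Matrix (Fin N) (Fin N) ℂ, ‖Z‖ < r → ‖exp Z - 1‖ < 1 / 6)
    (W₀ : Matrix.specialUnitaryGroup (Fin N) ℂ) (hg : ∀ i, ‖(V i : Matrix (Fin N) (Fin N) ℂ) * star (W₀ : Matrix (Fin N) (Fin N) ℂ) - 1‖ < deltaSU (Fin N))
    {X : (specialUnitaryLogChart (Fin N)).lie} (hX : ‖X‖ < r) :
    ‖Kmat (fun i => (V i : Matrix (Fin N) (Fin N) ℂ)) c ((W₀ : Matrix (Fin N) (Fin N) ℂ) * exp (X : Matrix (Fin N) (Fin N) ℂ)) -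
        Kmat (fun i => (V i : Matrix (Fin N) (Fin N) ℂ)) c (W₀ : Matrix (Fin N) (Fin N) ℂ)‖ ≤ 2 * B * ‖X‖ := by
  have hVu : ∀ i, (V i : Matrix (Fin N) (Fin N) ℂ) ∈ Matrix.unitaryGroup (Fin N) ℂ := fun i => (Matrix.mem_specialUnitaryGroup_iff.mp (V i).2).1
  have hW₀u : (W₀ : Matrix (Fin N) (Fin N) ℂ) ∈ Matrix.unitaryGroup (Fin N) ℂ := (Matrix.mem_specialUnitaryGroup_iff.mp W₀.2).1
  -- the chart map `G(Y) = Kmat V c (W₀ e^Y)` on the chart algebra and its derivative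
  set G : (specialUnitaryLogChart (Fin N)).lie → Matrix (Fin N) (Fin N) ℂ :=
    fun Y => Kmat (fun i => (V i : Matrix (Fin N) (Fin N) ℂ)) c ((W₀ : Matrix (Fin N) (Fin N) ℂ) * exp (Y : Matrix (Fin N) (Fin N) ℂ)) with hGdef
  set G' : (specialUnitaryLogChart (Fin N)).lie → ((specialUnitaryLogChart (Fin N)).lie →L[ℝ] Matrix (Fin N) (Fin N) ℂ) := fun Y =>
    (emlD (fun i => (V i : Matrix (Fin N) (Fin N) ℂ)) c ((W₀ : Matrix (Fin N) (Fin N) ℂ) * exp (Y : Matrix (Fin N) (Fin N) ℂ))).comp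
      ((ContinuousLinearMap.mul ℝ (Matrix (Fin N) (Fin N) ℂ) (W₀ : Matrix (Fin N) (Fin N) ℂ)).comp
        ((ContinuousLinearMap.mul ℝ (Matrix (Fin N) (Fin N) ℂ) (exp ((Y : (specialUnitaryLogChart (Fin N)).lie) : Matrix (Fin N) (Fin N) ℂ))).comp
          ((specialUnitaryLogChart (Fin N)).lie.subtypeL.comp (jac (lie_adStable_specialUnitaryGroup (n := Fin N)) Y)))) with hG'def
  -- every point of the ball is in the `1∕2`-guard
  have hguard : ∀ Y : (specialUnitaryLogChart (Fin N)).lie, ‖Y‖ < r →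
      ∀ i, ‖(V i : Matrix (Fin N) (Fin N) ℂ) * star ((W₀ : Matrix (Fin N) (Fin N) ℂ) * exp (Y : Matrix (Fin N) (Fin N) ℂ)) - 1‖ < 1 / 2 := by
    intro Y hY i
    have hYs : star (Y : Matrix (Fin N) (Fin N) ℂ) = -(Y : Matrix (Fin N) (Fin N) ℂ) := (mem_specialUnitaryLogChart_lie.1 Y.2).1
    refine guard_lt_half_of_exp hVu hW₀u hg hYs (hre _ ?_) i
    rwa [norm_neg, Submodule.norm_coe]
  have hexpu : ∀ Y : (specialUnitaryLogChart (Fin N)).lie, exp (Y : Matrix (Fin N) (Fin N) ℂ) ∈ Matrix.unitaryGroup (Fin N) ℂ := fun Y =>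
    (Matrix.mem_specialUnitaryGroup_iff.mp ((isChartRep_specialUnitaryGroup (n := Fin N)).expChart Y).2).1 |> fun h => by rwa [coe_expChart] at h
  have hderiv : ∀ Y ∈ Metric.ball (0 : (specialUnitaryLogChart (Fin N)).lie) r, HasFDerivWithinAt G (G' Y) (Metric.ball 0 r) Y := by
    intro Y hY
    rw [mem_ball_zero_iff] at hY
    have h1 : HasFDerivAt (fun Z : (specialUnitaryLogChart (Fin N)).lie => (W₀ : Matrix (Fin N) (Fin N) ℂ) * exp (Z : Matrix (Fin N) (Fin N) ℂ))
        ((ContinuousLinearMap.mul ℝ (Matrix (Fin N) (Fin N) ℂ) (W₀ : Matrix (Fin N) (Fin N) ℂ)).comp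
          ((ContinuousLinearMap.mul ℝ (Matrix (Fin N) (Fin N) ℂ) (exp ((Y : (specialUnitaryLogChart (Fin N)).lie) : Matrix (Fin N) (Fin N) ℂ))).comp
            ((specialUnitaryLogChart (Fin N)).lie.subtypeL.comp (jac (lie_adStable_specialUnitaryGroup (n := Fin N)) Y)))) Y :=
      (ContinuousLinearMap.mul ℝ (Matrix (Fin N) (Fin N) ℂ) (W₀ : Matrix (Fin N) (Fin N) ℂ)).hasFDerivAt.comp Y
        (hasFDerivAt_coe_exp (lie_adStable_specialUnitaryGroup (n := Fin N)) Y)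
    exact ((hasStrictFDerivAt_Kmat (fun i => (V i : Matrix (Fin N) (Fin N) ℂ)) c
      (fun i => (hguard Y hY i).trans (by norm_num))).hasFDerivAt.comp Y h1).hasFDerivWithinAt
  have hbound : ∀ Y ∈ Metric.ball (0 : (specialUnitaryLogChart (Fin N)).lie) r, ‖G' Y‖ ≤ 2 * B := by
    intro Y hY
    rw [mem_ball_zero_iff] at hY
    have hE : ‖emlD (fun i => (V i : Matrix (Fin N) (Fin N) ℂ)) c ((W₀ : Matrix (Fin N) (Fin N) ℂ) * exp (Y : Matrix (Fin N) (Fin N) ℂ))‖ ≤ B :=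
      hB _ _ hVu (mul_mem hW₀u (hexpu Y)) (fun i => (hguard Y hY i).le)
    have hW : ‖ContinuousLinearMap.mul ℝ (Matrix (Fin N) (Fin N) ℂ) (W₀ : Matrix (Fin N) (Fin N) ℂ)‖ ≤ 1 :=
      (ContinuousLinearMap.opNorm_mul_apply_le ℝ (Matrix (Fin N) (Fin N) ℂ) _).trans (CStarRing.norm_of_mem_unitary hW₀u).le
    have he : ‖ContinuousLinearMap.mul ℝ (Matrix (Fin N) (Fin N) ℂ) (exp ((Y : (specialUnitaryLogChart (Fin N)).lie) : Matrix (Fin N) (Fin N) ℂ))‖ ≤ 1 :=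
      (ContinuousLinearMap.opNorm_mul_apply_le ℝ (Matrix (Fin N) (Fin N) ℂ) _).trans (CStarRing.norm_of_mem_unitary (hexpu Y)).le
    have hsub : ‖(specialUnitaryLogChart (Fin N)).lie.subtypeL‖ ≤ 1 := Submodule.norm_subtypeL_le _
    have hj : ‖jac (lie_adStable_specialUnitaryGroup (n := Fin N)) Y‖ ≤ 2 := norm_jac_le_two (hY.le.trans hr2)
    calc ‖G' Y‖ ≤ ‖emlD (fun i => (V i : Matrix (Fin N) (Fin N) ℂ)) c ((W₀ : Matrix (Fin N) (Fin N) ℂ) * exp (Y : Matrix (Fin N) (Fin N) ℂ))‖ *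
          ‖(ContinuousLinearMap.mul ℝ (Matrix (Fin N) (Fin N) ℂ) (W₀ : Matrix (Fin N) (Fin N) ℂ)).comp
            ((ContinuousLinearMap.mul ℝ (Matrix (Fin N) (Fin N) ℂ) (exp ((Y : (specialUnitaryLogChart (Fin N)).lie) : Matrix (Fin N) (Fin N) ℂ))).comp
              ((specialUnitaryLogChart (Fin N)).lie.subtypeL.comp (jac (lie_adStable_specialUnitaryGroup (n := Fin N)) Y)))‖ :=
          ContinuousLinearMap.opNorm_comp_le _ _
      _ ≤ B * (1 * (1 * (1 * 2))) := by
          gcongr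
          refine (ContinuousLinearMap.opNorm_comp_le _ _).trans (mul_le_mul hW ?_ (norm_nonneg _) zero_le_one)
          refine (ContinuousLinearMap.opNorm_comp_le _ _).trans (mul_le_mul he ?_ (norm_nonneg _) zero_le_one)
          exact (ContinuousLinearMap.opNorm_comp_le _ _).trans (mul_le_mul hsub hj (norm_nonneg _) zero_le_one)
      _ = 2 * B := by ring
  have hmvt := (convex_ball (0 : (specialUnitaryLogChart (Fin N)).lie) r).norm_image_sub_le_of_norm_hasFDerivWithin_le hderiv hbound
    (Metric.mem_ball_self (lt_of_le_of_lt (norm_nonneg X) hX)) (mem_ball_zero_iff.2 hX)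
  have hG0 : G 0 = Kmat (fun i => (V i : Matrix (Fin N) (Fin N) ℂ)) c (W₀ : Matrix (Fin N) (Fin N) ℂ) := by
    simp only [hGdef, Submodule.coe_zero, exp_zero, mul_one]
  rw [hG0, sub_zero] at hmvt
  exact hmvt


end Summit.QuantumFields.YangMills.BalabanUVNodes.N08HaarCompatibilityGuardCoreWindowLipschitzSUN

end
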